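import Literature.AlgebraicGeometry.ShimuraVarieties.UnitaryAuxiliarySymplecticLevel
import Literature.AlgebraicGeometry.ShimuraVarieties.UnitaryAuxiliaryIntegralFrame
import Literature.NumberTheory.Adeles.CompactSubgroupStabilisesLattice
import HarnessLib

/-!
# The auxiliary level contains a given compact open subgroup: `K × L₀ ≤ K̃_β(1)`

Deligne's auxiliary construction [cite: Deligne1979ShimuraVarieties, Prop. 2.3.10 (PDF p. 32)],
[cite: Deligne1971TravauxShimura, Prop. 1.15 p. 132]: given compact subgroups `K ≤ U(H)(𝔸_f)` and
`L₀ ≤ T₀(M)(𝔸_f)`, the compact image of `K × L₀` in `GL_{(1⊕3)×[M:ℚ]}(𝔸_{ℚ,f})` under the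
frame-free carrier ★ `auxResFin` stabilises a full `ℤ`-lattice `Λ ⊆ M^{1⊕3}`
(★ `Adeles.exists_rat_conj_entries_mem_integralFiniteAdeles`); an integral symplectic frame `β` of
some polarization type `δ` adapted to `Λ` for a positive multiple `n • ψ` of the auxiliary form
(★ `exists_symplecticFrame_integral`) then reads every element of `K × L₀` as a matrix in
`GSp_δ(ℤ̂) = K_δ(1)`, i.e. `K × L₀ ≤ auxLevel F 1`.

Topic `AlgebraicGeometry/ShimuraVarieties`; namespace
`Literature.AlgebraicGeometry.ShimuraVarieties.UnitaryCanonicalModel.Aux`.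
-/

noncomputable section

open Matrix NumberField IsDedekindDomain
open scoped TensorProduct
open Literature.AlgebraicGeometry.ModuliOfAbelianVarieties Literature.LinearAlgebra.FreeModule
open Literature.NumberTheory.Automorphic (integralFiniteAdeles)

namespace Literature.AlgebraicGeometry.ShimuraVarieties.UnitaryCanonicalModel.Aux

open Literature.NumberTheory.Automorphic Literature.NumberTheory.Automorphic.UnitaryGroup

/-! ### §1. Matrix bookkeeping: integer conjugates of `𝒪̂`-integral adelic matrices -/

section Bookkeeping

variable {m n : Type}

/-- An adelic matrix with entries in `𝒪̂` is `≡ 1 (mod 1·𝒪̂)` (`levelIdeal 1 = 𝒪̂`).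
[cite: Deligne1971TravauxShimura, Exemple 4.16 p. 150] -/
theorem isCongOne_one_of_forall_mem_integral [DecidableEq n] {A : Matrix n n finAdeleQ}
    (hA : ∀ i k, A i k ∈ integralFiniteAdeles ℚ) : IsCongOne 1 A := by
  intro i k
  rw [mem_levelIdeal_iff]
  refine ⟨(A - 1) i k, ?_, by rw [Nat.cast_one, one_mul]⟩
  have hmem : (A - 1) i k ∈ integralFiniteAdeles ℚ := by
    rw [Matrix.sub_apply]
    refine sub_mem (hA i k) ?_
    rw [Matrix.one_apply]
    split_ifs
    · exact one_mem _
    · exact zero_mem _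
  exact ⟨fun v => ⟨(A - 1) i k v, hmem v⟩, FiniteAdeleRing.ext _ fun v => rfl⟩

/-- Integer matrices conjugate `𝒪̂`-integral matrices to `𝒪̂`-integral matrices:
the entries of `T_𝔸 · Y · T′_𝔸` are integral when those of `Y` are and `T, T′` are integer matrices.
[cite: PlatonovRapinchuk1994, §8.1] -/
theorem forall_mem_integral_intConj [Fintype n] (T : Matrix m n ℤ) (T' : Matrix n m ℤ) {Y : Matrix n n finAdeleQ}
    (hY : ∀ i k, Y i k ∈ integralFiniteAdeles ℚ) :
    ∀ i k, (T.map (Int.cast : ℤ → finAdeleQ) * Y * T'.map (Int.cast : ℤ → finAdeleQ)) i k ∈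
      integralFiniteAdeles ℚ := by
  intro i k
  rw [Matrix.mul_apply]
  refine sum_mem fun l _ => mul_mem ?_ (intCast_mem _ _)
  rw [Matrix.mul_apply]
  exact sum_mem fun l' _ => mul_mem (intCast_mem _ _) (hY l' l)

end Bookkeeping

/-! ### §2. The containment `K × L₀ ≤ K̃_β(1)` for an adapted integral frame -/

variable {L : Type} [Field L] [NumberField L] [IsCMField L] {M : Type} [Field M] [NumberField M]
  [IsCMField M] (j : L →+* M) (H : Matrix (Fin 3) (Fin 3) L) (ξ₀ ξ : M)

/-- **`K × L₀ ≤ K̃_β(1)` for a suitable integral frame** (Deligne's auxiliary construction, the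
level step): for `H` hermitian anisotropic, `ξ₀, ξ` nonzero purely imaginary and compact subgroups
`K ≤ U(H)(𝔸_f)`, `L₀ ≤ T₀(M)(𝔸_f)`, there are `n > 0`, `g > 0`, a polarization type `δ` and a
symplectic frame `F` of type `δ` for `auxForm M j H (n•ξ₀) (n•ξ)` with `K × L₀ ≤ auxLevel F 1`, i.e.
the framed carrier `ũ_β` maps `K × L₀` into the principal level `K_δ(1) = GSp_δ(ℤ̂)`.
[cite: Deligne1979ShimuraVarieties, Prop. 2.3.10 (PDF p. 32)]
[cite: Deligne1971TravauxShimura, Prop. 1.15 p. 132] -/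
theorem exists_symplecticFrame_prod_le_auxLevel_one (hH : Hᴴ = H) (hξ₀ : ξ₀ ≠ 0) (hξ : ξ ≠ 0)
    (hξ₀c : IsCMField.complexConj M ξ₀ = -ξ₀) (hξc : IsCMField.complexConj M ξ = -ξ)
    (hH0 : ∀ v : Fin 3 → L, hermForm (cmConjRingHom L) H v v = 0 → v = 0)
    (K : Subgroup ↥(finAdelic (↥(maximalRealSubfield L)) L (IsCMField.complexConj L) 3 H))
    (L₀ : Subgroup ↥(torusFinAdelic M))
    (hK : IsCompact (K : Set ↥(finAdelic (↥(maximalRealSubfield L)) L (IsCMField.complexConj L) 3 H)))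
    (hL₀ : IsCompact (L₀ : Set ↥(torusFinAdelic M))) :
    ∃ (n g : ℕ) (δ : Fin g → ℕ) (F : SymplecticFrame M j H ((n : ℚ) • ξ₀) ((n : ℚ) • ξ) g δ),
      0 < n ∧ 0 < g ∧ IsPolarizationType δ ∧ K.prod L₀ ≤ auxLevel F 1 := by
  classical
  -- the compact image `C` of `K × L₀` under the frame-free carrier
  set C : Subgroup (GL ((Fin 1 ⊕ Fin 3) × Fin (Module.finrank ℚ M)) finAdeleQ) :=
    (K.prod L₀).map (auxResFin M j H) with hC
  have hCc : IsCompact (C : Set (GL ((Fin 1 ⊕ Fin 3) × Fin (Module.finrank ℚ M)) finAdeleQ)) := by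
    rw [hC, Subgroup.coe_map, Subgroup.coe_prod]
    exact (hK.prod hL₀).image (continuous_auxResFin M j H)
  obtain ⟨γ, hγ⟩ := Literature.NumberTheory.Adeles.exists_rat_conj_entries_mem_integralFiniteAdeles C hCc
  -- the `γ`-twisted rational basis `c` of `U = M^{1⊕3}`: `c⁎ = γ ∘ e⁎`, `e = resBasis (ratBasis M)`
  set e : Module.Basis ((Fin 1 ⊕ Fin 3) × Fin (Module.finrank ℚ M)) ℚ ((Fin 1 ⊕ Fin 3) → M) :=
    resBasis (m := Fin 1 ⊕ Fin 3) (ratBasis M) with he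
  set γm : Matrix ((Fin 1 ⊕ Fin 3) × Fin (Module.finrank ℚ M)) ((Fin 1 ⊕ Fin 3) × Fin (Module.finrank ℚ M)) ℚ :=
    ((γ : GL ((Fin 1 ⊕ Fin 3) × Fin (Module.finrank ℚ M)) ℚ) :
      Matrix ((Fin 1 ⊕ Fin 3) × Fin (Module.finrank ℚ M)) ((Fin 1 ⊕ Fin 3) × Fin (Module.finrank ℚ M)) ℚ) with hγm
  set γi : Matrix ((Fin 1 ⊕ Fin 3) × Fin (Module.finrank ℚ M)) ((Fin 1 ⊕ Fin 3) × Fin (Module.finrank ℚ M)) ℚ :=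
    ((γ⁻¹ : GL ((Fin 1 ⊕ Fin 3) × Fin (Module.finrank ℚ M)) ℚ) :
      Matrix ((Fin 1 ⊕ Fin 3) × Fin (Module.finrank ℚ M)) ((Fin 1 ⊕ Fin 3) × Fin (Module.finrank ℚ M)) ℚ) with hγi
  have hγmi : γm * γi = 1 := by rw [hγm, hγi, ← Units.val_mul, mul_inv_cancel, Units.val_one]
  have hγim : γi * γm = 1 := by rw [hγm, hγi, ← Units.val_mul, inv_mul_cancel, Units.val_one]
  let θγ : (((Fin 1 ⊕ Fin 3) × Fin (Module.finrank ℚ M)) → ℚ) ≃ₗ[ℚ]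
      (((Fin 1 ⊕ Fin 3) × Fin (Module.finrank ℚ M)) → ℚ) :=
    LinearEquiv.ofLinear (Matrix.toLin' γm) (Matrix.toLin' γi)
      (by rw [← Matrix.toLin'_mul, hγmi, Matrix.toLin'_one])
      (by rw [← Matrix.toLin'_mul, hγim, Matrix.toLin'_one])
  let c : Module.Basis ((Fin 1 ⊕ Fin 3) × Fin (Module.finrank ℚ M)) ℚ ((Fin 1 ⊕ Fin 3) → M) :=
    Module.Basis.ofEquivFun (e.equivFun.trans θγ)
  have hc : ∀ u, c.equivFun u = γm *ᵥ e.equivFun u := fun u => by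
    rw [Module.Basis.equivFun_ofEquivFun]
    exact Matrix.toLin'_apply γm _
  -- the integral frame adapted to `c`
  obtain ⟨n, g, δ, F, T, T', hn, hg, hδ, hTT', hT'T, -, hβ⟩ :=
    exists_symplecticFrame_integral j H ξ₀ ξ c hH hξ₀ hξ hξ₀c hξc hH0
  refine ⟨n, g, δ, F, hn, hg, hδ, ?_⟩
  -- frame matrices: `P = T γ`, `Q = γ⁻¹ T′`
  set Tq : Matrix (Fin g ⊕ Fin g) ((Fin 1 ⊕ Fin 3) × Fin (Module.finrank ℚ M)) ℚ :=
    T.map (Int.cast : ℤ → ℚ) with hTq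
  set T'q : Matrix ((Fin 1 ⊕ Fin 3) × Fin (Module.finrank ℚ M)) (Fin g ⊕ Fin g) ℚ :=
    T'.map (Int.cast : ℤ → ℚ) with hT'q
  have hTT'q : Tq * T'q = 1 := by
    rw [hTq, hT'q, ← map_intCast_mul, hTT', Matrix.map_one Int.cast Int.cast_zero Int.cast_one]
  have hT'Tq : T'q * Tq = 1 := by
    rw [hTq, hT'q, ← map_intCast_mul, hT'T, Matrix.map_one Int.cast Int.cast_zero Int.cast_one]
  have hes : ∀ ik, e.equivFun (e ik) = Pi.single ik 1 := fun ik => by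
    rw [Module.Basis.equivFun_apply, e.repr_self, Finsupp.single_eq_pi_single]
  have hP : frameP F = Tq * γm := by
    ext a ik
    rw [frameP, LinearMap.toMatrix_apply, Pi.basisFun_repr, LinearEquiv.coe_coe, ← he, hβ, hc,
      hes, Matrix.mulVec_mulVec, Matrix.mulVec_single_one, Matrix.col_apply]
  have hQ : frameQ F = γi * T'q := by
    have h1 : (γi * T'q) * frameP F = 1 := by
      rw [hP, Matrix.mul_assoc, ← Matrix.mul_assoc T'q, hT'Tq, Matrix.one_mul, hγim]
    calc frameQ F = (γi * T'q) * frameP F * frameQ F := by rw [h1, Matrix.one_mul]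
      _ = γi * T'q := by rw [Matrix.mul_assoc, frameP_mul_frameQ, Matrix.mul_one]
  -- over `𝔸_{ℚ,f}`
  set ι𝔸 : ℚ →+* finAdeleQ := algebraMap ℚ finAdeleQ with hι
  have hPA : framePR finAdeleQ F = T.map (Int.cast : ℤ → finAdeleQ) * γm.map ι𝔸 := by
    rw [framePR, hP, ← hι, Matrix.map_mul, hTq, Matrix.map_map]
    congr 1
    ext a ik
    simp only [Matrix.map_apply, Function.comp_apply, map_intCast]
  have hQA : frameQR finAdeleQ F = γi.map ι𝔸 * T'.map (Int.cast : ℤ → finAdeleQ) := by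
    rw [frameQR, hQ, ← hι, Matrix.map_mul, hT'q, Matrix.map_map]
    congr 1
    ext ik a
    simp only [Matrix.map_apply, Function.comp_apply, map_intCast]
  have hγA : ((Matrix.GeneralLinearGroup.map ι𝔸 γ : GL ((Fin 1 ⊕ Fin 3) × Fin (Module.finrank ℚ M)) finAdeleQ) : Matrix ((Fin 1 ⊕ Fin 3) × Fin (Module.finrank ℚ M)) ((Fin 1 ⊕ Fin 3) × Fin (Module.finrank ℚ M)) finAdeleQ) =
      γm.map ι𝔸 := rfl
  have hγA' : (((Matrix.GeneralLinearGroup.map ι𝔸 γ)⁻¹ : GL ((Fin 1 ⊕ Fin 3) × Fin (Module.finrank ℚ M)) finAdeleQ) : Matrix ((Fin 1 ⊕ Fin 3) × Fin (Module.finrank ℚ M)) ((Fin 1 ⊕ Fin 3) × Fin (Module.finrank ℚ M)) finAdeleQ) =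
      γi.map ι𝔸 := by
    rw [← map_inv]; rfl
  -- the containment
  rintro p hp
  have hX : auxResFin M j H p ∈ C := by
    rw [hC]; exact Subgroup.mem_map_of_mem _ hp
  obtain ⟨h1, h2⟩ := hγ _ hX
  rw [mem_auxLevel_iff]
  have key : ∀ Z : GL ((Fin 1 ⊕ Fin 3) × Fin (Module.finrank ℚ M)) finAdeleQ,
      (∀ i k, ((Matrix.GeneralLinearGroup.map ι𝔸 γ * Z * (Matrix.GeneralLinearGroup.map ι𝔸 γ)⁻¹ :
        GL ((Fin 1 ⊕ Fin 3) × Fin (Module.finrank ℚ M)) finAdeleQ) : Matrix ((Fin 1 ⊕ Fin 3) × Fin (Module.finrank ℚ M)) ((Fin 1 ⊕ Fin 3) × Fin (Module.finrank ℚ M)) finAdeleQ) i k ∈ integralFiniteAdeles ℚ) →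
      IsCongOne 1 (framePR finAdeleQ F * (Z : Matrix ((Fin 1 ⊕ Fin 3) × Fin (Module.finrank ℚ M)) ((Fin 1 ⊕ Fin 3) × Fin (Module.finrank ℚ M)) finAdeleQ) * frameQR finAdeleQ F) := by
    intro Z hZ
    rw [Units.val_mul, Units.val_mul, hγA, hγA'] at hZ
    have hmul : framePR finAdeleQ F * (Z : Matrix ((Fin 1 ⊕ Fin 3) × Fin (Module.finrank ℚ M)) ((Fin 1 ⊕ Fin 3) × Fin (Module.finrank ℚ M)) finAdeleQ) * frameQR finAdeleQ F =
        T.map (Int.cast : ℤ → finAdeleQ) * (γm.map ι𝔸 * (Z : Matrix ((Fin 1 ⊕ Fin 3) × Fin (Module.finrank ℚ M)) ((Fin 1 ⊕ Fin 3) × Fin (Module.finrank ℚ M)) finAdeleQ) * γi.map ι𝔸) *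
          T'.map (Int.cast : ℤ → finAdeleQ) := by
      rw [hPA, hQA]
      simp only [Matrix.mul_assoc]
    rw [hmul]
    exact isCongOne_one_of_forall_mem_integral (forall_mem_integral_intConj T T' hZ)
  refine ⟨?_, ?_⟩
  · rw [coe_auxToGspFin_eq_conjRect]
    exact key _ h1
  · rw [coe_auxToGspFin_eq_conjRect, ← map_inv]
    exact key _ h2

end Literature.AlgebraicGeometry.ShimuraVarieties.UnitaryCanonicalModel.Aux

end
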